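import Literature.AlgebraicGeometry.AbelianSchemes.PolarizationLamFinrank
import Literature.AlgebraicGeometry.Modules.PushforwardUnitHasRankOfFinrank
import HarnessLib

/-!
# A polarisation of type `δ` has degree `∏ δᵢ` — [MFK] Def. 7.2 (ii) «`ϖ_*(o_X)` is locally free of rank `d²`»

Topic `AlgebraicGeometry/AbelianSchemes`; namespace `Literature.AlgebraicGeometry.AbelianSchemes.AbelianSchemeOver.Polarization`.
ONE theorem (no definition, no named fact, no instance, no `sorry`).

[MumfordFogartyKirwan1994] Ch. 7 §2 Def. 7.2 (p. 129): «(ii) a polarization `ϖ : X → X̂` of degree `d²`, i.e., `ϖ_*(o_X)` is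
locally free of rank `d²`»; App. 7A (pp. 234–235): the type `δ`, `∏ δᵢ = d`.

The tree's polarisation carrier ★ `AbelianSchemePolarization` (cell hodgecm-mathlib M1PRIME-DAG §5 D2) left «over `ℚ`-schemes
`Polarization.HasType δ → Polarization.HasDegree (polarizationDegree δ)`» as an OWED prover leaf (docstring :317).  This file
discharges it over any locally noetherian base of characteristic zero, for polarisations whose geometric fibres are
isogenies (`hiso`, the shape of ★ `SiegelFineModuliScheme.isIsogeny_fibreHom_lam_of_classify` /
★ `PolarizedAbelianSchemeWithLevel.isIsogeny_fibreHom_lam_of_locallyOfFiniteType`): compose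
★ `Polarization.finrank_lam_left_eq_of_hasType` (`rk λ ≡ (∏ δᵢ)²`, `AbelianSchemes/PolarizationLamFinrank`) with the
dictionary ★ `Modules.hasRank_pushforward_unit_of_finrank_eq` (`HasRank (f_*𝒪) n ⇐ rk f ≡ n`,
`Modules/PushforwardUnitHasRankOfFinrank`), the total space `Â` being locally noetherian (smooth over `S`, Mathlib
`LocallyOfFiniteType.isLocallyNoetherian`).

COUNT-NEUTRAL capital (price pen B-p03 (g16) 2026-08-30T03:36:18Z: consumers MFK Def. 7.2's degree reading of the type-`δ`
functor, F-6 (V) / App. 7A, F-9 (a) numerics).  HC_CM is proved only modulo the 7 printed citations until rung 0 closes; this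
file discharges none of them.

## References
* [MumfordFogartyKirwan1994] D. Mumford, J. Fogarty, F. Kirwan, *Geometric Invariant Theory*, 3rd ed. (1994), Ch. 7 §2
  Definition 7.2 (p. 129); App. 7A (pp. 234–235).
-/

set_option autoImplicit false

noncomputable section

universe u

open CategoryTheory CategoryTheory.Limits AlgebraicGeometry
open Literature.AlgebraicGeometry.Motives Literature.AlgebraicGeometry.Motives.AbelianVariety
open Literature.AlgebraicGeometry.ModuliOfAbelianVarieties (polarizationDegree)

namespace Literature.AlgebraicGeometry.AbelianSchemes

namespace AbelianSchemeOver

variable {S : Scheme.{u}} {A : AbelianSchemeOver S} {D : A.DualPair} (pol : A.Polarization D) {g : ℕ} {δ : Fin g → ℕ}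

/-- **A polarisation of TYPE `δ` has DEGREE `∏ δᵢ`** ([MumfordFogartyKirwan1994] Def. 7.2 (ii): `λ_* 𝒪_A` is locally free of
rank `d² = (∏ δᵢ)²`, the tree's `Polarization.HasDegree`) — over a locally noetherian base of characteristic zero
(`f : S ⟶ Spec K`, `CharZero K`) and for geometric fibres isogenies (`hiso`): `λ` is finite flat of rank `(∏ δᵢ)²` at every
point (★ `finrank_lam_left_eq_of_hasType`), hence `λ_* 𝒪_A` has rank `(∏ δᵢ)²` (★ `hasRank_pushforward_unit_of_finrank_eq`;
`Â` is locally noetherian, being smooth over `S`).  The owed D2 leaf «`HasType δ → HasDegree (polarizationDegree δ)`».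
[cite: MumfordFogartyKirwan1994, Ch. 7 §2 Definition 7.2 (p. 129)] -/
theorem Polarization.hasDegree_of_hasType [IsMonHom pol.lam] (hT : pol.HasType δ) {K : Type u} [Field K] [CharZero K]
    (f : S ⟶ Spec (.of K)) [IsLocallyNoetherian S]
    (hiso : ∀ ⦃Ω : Type u⦄ [Field Ω] [IsAlgClosed Ω] (t : Spec (.of Ω) ⟶ S), IsIsogeny (fibreHom pol.lam t)) :
    pol.HasDegree (polarizationDegree δ) := by
  haveI := pol.flat_lam_left hiso
  haveI := pol.isFinite_lam_left_of_charZero f hiso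
  haveI : Smooth D.hat.X.hom := D.hat.isSmooth
  haveI : IsLocallyNoetherian D.hat.X.left := LocallyOfFiniteType.isLocallyNoetherian D.hat.X.hom
  exact (pol.hasDegree_iff _).mpr
    (Modules.hasRank_pushforward_unit_of_finrank_eq pol.lam.left _ (pol.finrank_lam_left_eq_of_hasType hT f hiso))

end AbelianSchemeOver

end Literature.AlgebraicGeometry.AbelianSchemes

end
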